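import Summits.BirchSwinnertonDyer.BirchSwinnertonDyer.Theorems.ClassRecordThreeEulerHalvesAtThreeSection6JoinedAdm
import Summits.BirchSwinnertonDyer.BirchSwinnertonDyer.Theorems.ClassRecordThreeEulerHalvesAtThreeWalkConductors
import Summits.BirchSwinnertonDyer.BirchSwinnertonDyer.Theorems.ClassRecordThreeEulerHalvesAtThreeWalkStructures
import Summits.BirchSwinnertonDyer.BirchSwinnertonDyer.Theorems.KolyvaginRoadThreeMethod2Step
import Summits.BirchSwinnertonDyer.Rank1Residual.X11b.Three.KolyvaginLine
import HarnessLib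

/-!
# The Jetchev WALK on the row objects (ORDERED, BASED form) with the ČEBOTAREV input as a HYPOTHESIS —
# image-agnostic twin of tam3's `tamagawaExponent_le_m_of_orderedFamiliesBase` for the non-surjective
# corner (cell `bsd-stepL`, seat `bsd-stepL-corner-p1` g11; `--supports stmt-BirchSwinnertonDyer-19947`)

WHY. tam3-p1's `Koly.tamagawaExponent_le_m_of_orderedFamiliesBase` (p511447-series, file
`…WalkFamiliesOrderedBase`) instantiates bsd-jet's abstract §6 kernel on the row objects and consumes the
surjectivity of `ρ̄_{E,p}` in exactly ONE place: Jetchev's Lemma 6.1 ∕ McCallum Cor. 3.2 (the Čebotarev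
prime keeping two eigen-classes non-zero at depth `k + j`), through
`Koly.exists_kolyvaginPrime_addOrderOf_localization_eq_shift` (`hρ`). On the corner (`E[p]` irreducible, `ρ̄` NOT
onto) the same conclusion is this seat's `…_of_irr_of_neg` (p501512; `−1 ∈ ρ̄(Γ_ℚ)` + a
disjointness prime `q ∣ d_K`) and `…_of_irr_five` (p513987; no `−1` binder at `p = 5`). THIS FILE copies
tam3's theorem VERBATIM with the Čebotarev conclusion abstracted into the hypothesis `hCeb` (shape = the
common conclusion of the three suppliers, `τ` and `k` fixed) and the binders `hp2`, `hρ` dropped — so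
that ONE walk serves Surj (tam3), the T4′ corner (`p ∈ {5,7}`) and the T4″@3 corner. Proof: tam3's, byte
for byte, except the single `obtain … := hCeb …` line. HONEST FRAMING: one theorem, no definition ∕ fact ∕
sorry; every level-indexed input is a hypothesis exactly as in tam3's file; no stub closes; nothing about any curve;
T7. Credit: tam3-p1 ∕ bsd-jet. The binders `hK`, `hτ`, `hk` fed only the Čebotarev call and are dropped too. References:
[cite: Jetchev2008, §3.1, §4.2–4.3, Prop. 4.7, 4.9, Thm. 5.1, Lemma 5.2, 6.1, Thm. 6.3, Prop. 6.4] [cite: McCallumLMS1991, §3 Cor. 3.2].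
-/

set_option autoImplicit false

noncomputable section

open scoped Classical NumberField

namespace Summit.BirchSwinnertonDyer.Rank1Residual.X11b.Three.Koly

open WeierstrassCurve IsDedekindDomain NumberField Literature.NumberTheory.EllipticCurves
  Literature.NumberTheory.EllipticCurves.ModularForms Literature.NumberTheory.EllipticCurves.Jetchev2008
  Literature.NumberTheory.GaloisRepresentations
  Literature.NumberTheory.GaloisRepresentations.DiscreteGaloisModule
  Summit.BirchSwinnertonDyer.Rank1Residual.JET

/-- **The kernel §6 walk on the row objects (ORDERED, BASED shapes), Čebotarev as hypothesis: `ord_p c_q ≤ m(c)`** —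
tam3's `tamagawaExponent_le_m_of_orderedFamiliesBase` with `hρ` replaced by `hCeb` (Lemma 6.1 at depth `k + j`).
[cite: Jetchev2008, Prop. 6.4, Thm. 6.3, Lemma 6.1, pp. 822–825] [cite: McCallumLMS1991, §3 Cor. 3.2, §4 Prop. 4.4] -/
theorem tamagawaExponent_le_m_of_orderedFamiliesBase_of_chebotarev
    (W : WeierstrassCurve ℚ) [W.IsElliptic] [W.IsGloballyMinimal] [NeZero (W.conductorNorm ℤ)]
    (K : Type) [Field K] [NumberField K] (p : ℕ) [Fact p.Prime]
    (Dt : ModularParametrizationData W (W.conductorNorm ℤ)) (β : ℤ) (ι : K →+* ℂ)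
    (τ : K ≃ₐ[ℚ] K) (k t : ℕ) (htk : t ≤ k)
    (hCeb : ∀ (j : ℕ) {e : ℤ}, (e = 1 ∨ e = -1) →
      ∀ (x y : galH1Torsion (W.baseChange K) ((p ^ k : ℕ) : ℤ)),
      conjAct W τ ((p ^ k : ℕ) : ℤ) x = e • x → conjAct W τ ((p ^ k : ℕ) : ℤ) y = (-e) • y → y ≠ 0 →
      ∀ b : ℕ, ∃ ℓ : ℕ, b < ℓ ∧ Zhang2014.IsKolyvaginPrime (W.conductorNorm ℤ) W K p ℓ ∧
        k + j ≤ Zhang2014.kolyvaginIndex W p ℓ ∧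
        ∀ v : HeightOneSpectrum (𝓞 K), (ℓ : 𝓞 K) ∈ v.asIdeal →
          addOrderOf (galoisCohomology.localization
              ((W.baseChange K).torsionGaloisModule ((p ^ k : ℕ) : ℤ)) (Sum.inr v) 1 x) = addOrderOf x ∧
          addOrderOf (galoisCohomology.localization
              ((W.baseChange K).torsionGaloisModule ((p ^ k : ℕ) : ℤ)) (Sum.inr v) 1 y) = addOrderOf y)
    (𝒯 𝒮 : SelmerStructure ((W.baseChange K).torsionGaloisModule ((p ^ k : ℕ) : ℤ)))
    (hS : ∀ v, 𝒮 v ≤ (W.baseChange K).kummerSelmerStructure ((p ^ k : ℕ) : ℤ) v)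
    (Qcar : Finset (HeightOneSpectrum (𝓞 K)))
    (hQcar : ∀ v ∈ Qcar, ((W.conductorNorm ℤ : ℕ) : 𝓞 K) ∈ v.asIdeal)
    (D : ∀ s : {m : ℕ // Squarefree m ∧ ∀ q ∈ m.primeFactors,
        Zhang2014.IsKolyvaginPrime (W.conductorNorm ℤ) W K p q ∧ k ≤ Zhang2014.kolyvaginIndex W p q},
      KolyvaginHeegnerData Dt β ι s.1)
    (eb : ℕ → Bool) (heb : ∀ (m ℓ : ℕ), ℓ.Prime → ¬ ℓ ∣ m → eb (m * ℓ) = !eb m)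
    (c : ℕ) (hc : Squarefree c ∧ ∀ q ∈ c.primeFactors,
      Zhang2014.IsKolyvaginPrime (W.conductorNorm ℤ) W K p q ∧ k ≤ Zhang2014.kolyvaginIndex W p q)
    (h0 : (if divOrd (D ⟨c, hc⟩) p < Zhang2014.levelIndex W p c then divOrd (D ⟨c, hc⟩) p
      else (⊤ : ℕ∞)) < (k : ℕ∞))
    (hMc : (k : ℕ∞) + (if divOrd (D ⟨c, hc⟩) p < Zhang2014.levelIndex W p c then divOrd (D ⟨c, hc⟩) p
      else ⊤) ≤ Zhang2014.levelIndex W p c)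
    (hdisj : ∀ (ℓ : ℕ), Zhang2014.IsKolyvaginPrime (W.conductorNorm ℤ) W K p ℓ →
      k ≤ Zhang2014.kolyvaginIndex W p ℓ → ¬ ℓ ∣ c → ∀ v : HeightOneSpectrum (𝓞 K), (ℓ : 𝓞 K) ∈ v.asIdeal →
      Disjoint ((W.baseChange K).kummerSelmerStructure ((p ^ k : ℕ) : ℤ) (Sum.inr v)) (𝒯 (Sum.inr v)))
    (hfin : ∀ (m : ℕ) (v : HeightOneSpectrum (𝓞 K)),
      Finite ((selmerF W ((p ^ k : ℕ) : ℤ) 𝒯 (placesDividing K m)).relaxedAt {v}).selmerGroup)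
    (hPT : ∀ (s : {m : ℕ // Squarefree m ∧ ∀ q ∈ m.primeFactors,
        Zhang2014.IsKolyvaginPrime (W.conductorNorm ℤ) W K p q ∧ k ≤ Zhang2014.kolyvaginIndex W p q})
      (ℓ : ℕ), Zhang2014.IsKolyvaginPrime (W.conductorNorm ℤ) W K p ℓ →
      k ≤ Zhang2014.kolyvaginIndex W p ℓ → ¬ ℓ ∣ s.1 → (∀ q ∈ s.1.primeFactors, q < ℓ) → c ∣ s.1 →
      ∀ v : HeightOneSpectrum (𝓞 K), (ℓ : 𝓞 K) ∈ v.asIdeal → ∀ b : Bool,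
      Nat.card ((signPart W K τ ((p ^ k : ℕ) : ℤ) (if b then 1 else -1)
          ((selmerF W ((p ^ k : ℕ) : ℤ) 𝒯 (placesDividing K s.1)).relaxedAt {v}).selmerGroup).map
        (galoisCohomology.localization ((W.baseChange K).torsionGaloisModule ((p ^ k : ℕ) : ℤ))
          (Sum.inr v) 1)) = p ^ k)
    (hκt : ∀ s, c ∣ s.1 →
      (if divOrd (D s) p < Zhang2014.levelIndex W p s.1 then divOrd (D s) p else (⊤ : ℕ∞)) +
        (k : ℕ∞) ≤ Zhang2014.levelIndex W p s.1 →
      ∃ x : galoisCohomology ((W.baseChange K).torsionGaloisModule ((p ^ k : ℕ) : ℤ)) 1,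
        x ∈ signPart W K τ ((p ^ k : ℕ) : ℤ) (if eb s.1 then 1 else -1)
          (selmerF W ((p ^ k : ℕ) : ℤ) 𝒯 (placesDividing K s.1)).selmerGroup ∧
        addOrderOf x = p ^ k ∧
        ((D s).kolyvaginClass (Fact.out : p.Prime) k :
            galoisCohomology ((W.baseChange K).torsionGaloisModule ((p ^ k : ℕ) : ℤ)) 1) =
          p ^ (if divOrd (D s) p < Zhang2014.levelIndex W p s.1 then divOrd (D s) p
            else (⊤ : ℕ∞)).toNat • x)
    (hordκ : ∀ s (j : ℕ), j < k →
      p ^ (k - j) ∣ addOrderOf ((D s).kolyvaginClass (Fact.out : p.Prime) k :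
        galoisCohomology ((W.baseChange K).torsionGaloisModule ((p ^ k : ℕ) : ℤ)) 1) →
      divOrd (D s) p ≤ (j : ℕ∞))
    (h47 : ∀ (s s' : {m : ℕ // Squarefree m ∧ ∀ q ∈ m.primeFactors,
        Zhang2014.IsKolyvaginPrime (W.conductorNorm ℤ) W K p q ∧ k ≤ Zhang2014.kolyvaginIndex W p q}) (ℓ : ℕ),
      ℓ.Prime → ¬ ℓ ∣ s.1 → s'.1 = s.1 * ℓ → (∀ q ∈ s.1.primeFactors, q < ℓ) → c ∣ s.1 →
      ∀ v : HeightOneSpectrum (𝓞 K), (ℓ : 𝓞 K) ∈ v.asIdeal →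
      addOrderOf (galoisCohomology.localization ((W.baseChange K).torsionGaloisModule ((p ^ k : ℕ) : ℤ))
          (Sum.inr v) 1 ((D s').kolyvaginClass (Fact.out : p.Prime) k)) =
        addOrderOf (galoisCohomology.localization ((W.baseChange K).torsionGaloisModule ((p ^ k : ℕ) : ℤ))
          (Sum.inr v) 1 ((D s).kolyvaginClass (Fact.out : p.Prime) k)))
    (C' : ℕ → AddSubgroup (galoisCohomology ((W.baseChange K).torsionGaloisModule ((p ^ k : ℕ) : ℤ)) 1))
    (hC : ∀ m, C' m ≤ signPart W K τ ((p ^ k : ℕ) : ℤ) (if !eb m then 1 else -1) ⊤)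
    (hdual_q : ∀ s : {m : ℕ // Squarefree m ∧ ∀ q ∈ m.primeFactors,
        Zhang2014.IsKolyvaginPrime (W.conductorNorm ℤ) W K p q ∧ k ≤ Zhang2014.kolyvaginIndex W p q},
      c ∣ s.1 → ∃ (Qg Qg' : Type) (_ : AddCommGroup Qg) (_ : AddCommGroup Qg') (_ : Finite Qg')
        (locq : signPart W K τ ((p ^ k : ℕ) : ℤ) (if !eb s.1 then 1 else -1)
            (selmerF W ((p ^ k : ℕ) : ℤ) 𝒯 (placesDividing K s.1)).selmerGroup →+ Qg)
        (locq' : C' s.1 →+ Qg'),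
        (∀ x : C' s.1, locq' x = 0 ↔
          (x : galoisCohomology ((W.baseChange K).torsionGaloisModule ((p ^ k : ℕ) : ℤ)) 1) ∈
            signPart W K τ ((p ^ k : ℕ) : ℤ) (if !eb s.1 then 1 else -1)
              (selmerF W ((p ^ k : ℕ) : ℤ) 𝒯 (placesDividing K s.1)).selmerGroup) ∧
        Nat.card locq.range * Nat.card locq'.range = Nat.card Qg' ∧ IsAddCyclic Qg' ∧
        Nat.card Qg' = p ^ t)
    (h49 : ∀ (s s' : {m : ℕ // Squarefree m ∧ ∀ q ∈ m.primeFactors,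
        Zhang2014.IsKolyvaginPrime (W.conductorNorm ℤ) W K p q ∧ k ≤ Zhang2014.kolyvaginIndex W p q}) (ℓ : ℕ),
      ℓ.Prime → ¬ ℓ ∣ s.1 → s'.1 = s.1 * ℓ → (∀ q ∈ s.1.primeFactors, q < ℓ) → c ∣ s.1 →
      ∀ v : HeightOneSpectrum (𝓞 K), (ℓ : 𝓞 K) ∈ v.asIdeal →
      ((D s').kolyvaginClass (Fact.out : p.Prime) k :
          galoisCohomology ((W.baseChange K).torsionGaloisModule ((p ^ k : ℕ) : ℤ)) 1) ∈
        signPart W K τ ((p ^ k : ℕ) : ℤ) (if !eb s.1 then 1 else -1)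
          (((selmerF0 W ((p ^ k : ℕ) : ℤ) 𝒯 𝒮 (placesDividing K s.1) Qcar).relaxedAt {v}).selmerGroup))
    (hdual_ℓ : ∀ (s : {m : ℕ // Squarefree m ∧ ∀ q ∈ m.primeFactors,
        Zhang2014.IsKolyvaginPrime (W.conductorNorm ℤ) W K p q ∧ k ≤ Zhang2014.kolyvaginIndex W p q})
      (ℓ : ℕ), Zhang2014.IsKolyvaginPrime (W.conductorNorm ℤ) W K p ℓ →
      k ≤ Zhang2014.kolyvaginIndex W p ℓ → ¬ ℓ ∣ s.1 → (∀ q ∈ s.1.primeFactors, q < ℓ) → c ∣ s.1 →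
      ∀ v : HeightOneSpectrum (𝓞 K), (ℓ : 𝓞 K) ∈ v.asIdeal →
      ∃ (Sg : Type) (_ : AddCommGroup Sg)
        (sing : signPart W K τ ((p ^ k : ℕ) : ℤ) (if !eb s.1 then 1 else -1)
            (((selmerF0 W ((p ^ k : ℕ) : ℤ) 𝒯 𝒮 (placesDividing K s.1) Qcar).relaxedAt {v}).selmerGroup)
          →+ Sg),
        (∀ x, sing x = 0 ↔
          (x : galoisCohomology ((W.baseChange K).torsionGaloisModule ((p ^ k : ℕ) : ℤ)) 1) ∈
            signPart W K τ ((p ^ k : ℕ) : ℤ) (if !eb s.1 then 1 else -1)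
              ((selmerF0 W ((p ^ k : ℕ) : ℤ) 𝒯 𝒮 (placesDividing K s.1) Qcar).selmerGroup)) ∧
        Nat.card sing.range *
          Nat.card ((C' s.1).map (galoisCohomology.localization
            ((W.baseChange K).torsionGaloisModule ((p ^ k : ℕ) : ℤ)) (Sum.inr v) 1)) = p ^ k) :
    (t : ℕ∞) ≤ (if divOrd (D ⟨c, hc⟩) p < Zhang2014.levelIndex W p c then divOrd (D ⟨c, hc⟩) p
      else ⊤) := by
  have hp : p.Prime := Fact.out
  have hc0 : c ≠ 0 := hc.1.ne_zero
  -- ### `u := m(c)` as a natural number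
  set mcc : ℕ∞ := (if divOrd (D ⟨c, hc⟩) p < Zhang2014.levelIndex W p c then divOrd (D ⟨c, hc⟩) p
    else (⊤ : ℕ∞)) with hmcc_def
  have hmcc_ne : mcc ≠ ⊤ := ne_top_of_lt h0
  set u : ℕ := mcc.toNat with hu
  have hmcu : mcc = (u : ℕ∞) := (ENat.coe_toNat hmcc_ne).symm
  have hku : ((k + u : ℕ) : ℕ∞) = (k : ℕ∞) + mcc := by rw [hmcu]; push_cast; rfl
  have hcidx : ∀ q ∈ c.primeFactors, k + u ≤ Zhang2014.kolyvaginIndex W p q :=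
    Zhang2014.natCast_le_levelIndex_iff.mp (hku ▸ hMc)
  -- ### the pool of primes `P` and the place `λ(ℓ)`
  let P : Type := {ℓ : ℕ // Zhang2014.IsKolyvaginPrime (W.conductorNorm ℤ) W K p ℓ ∧
    k + u ≤ Zhang2014.kolyvaginIndex W p ℓ ∧ ¬ ℓ ∣ c}
  have hPprime : ∀ ℓ : P, (ℓ : ℕ).Prime := fun ℓ ↦ ℓ.2.1.1
  have hPk : ∀ ℓ : P, k ≤ Zhang2014.kolyvaginIndex W p ℓ := fun ℓ ↦ le_trans (Nat.le_add_right k u) ℓ.2.2.1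
  let lam : P → HeightOneSpectrum (𝓞 K) := fun ℓ ↦
    ⟨Ideal.span {((ℓ : ℕ) : 𝓞 K)}, ℓ.2.1.2.2.2.2.1, by
      rw [Ne, Ideal.span_singleton_eq_bot]
      exact_mod_cast (hPprime ℓ).ne_zero⟩
  have hlam_mem : ∀ ℓ : P, ((ℓ : ℕ) : 𝓞 K) ∈ (lam ℓ).asIdeal := fun ℓ ↦ Ideal.mem_span_singleton_self _
  -- ### the conductors `c·∏ n` (an opaque function with its specification)
  obtain ⟨cond, hcond⟩ : ∃ cond : Finset P → ℕ, ∀ n, cond n = c * ∏ ℓ ∈ n, (ℓ : ℕ) :=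
    ⟨_, fun _ ↦ rfl⟩
  have hcond_empty : cond ∅ = c := by rw [hcond, Finset.prod_empty, mul_one]
  have hcond_insert : ∀ (n : Finset P) (ℓ : P), ℓ ∉ n → cond (insert ℓ n) = cond n * ℓ := by
    intro n ℓ hℓ
    rw [hcond, hcond, Finset.prod_insert hℓ]
    ring
  -- admissibility of every conductor of the walk
  have hadm : ∀ n : Finset P, (Squarefree (cond n) ∧
      ∀ q ∈ (cond n).primeFactors, Zhang2014.IsKolyvaginPrime (W.conductorNorm ℤ) W K p q ∧
        k ≤ Zhang2014.kolyvaginIndex W p q) ∧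
      (∀ q ∈ (cond n).primeFactors, k + u ≤ Zhang2014.kolyvaginIndex W p q) ∧
      (∀ ℓ : P, ℓ ∉ n → ¬ (ℓ : ℕ) ∣ cond n) := by
    intro n
    obtain ⟨hsq, hfac, hnd⟩ := Walk.squarefree_mul_prod_facts (fun ℓ : P ↦ (ℓ : ℕ))
      Subtype.val_injective hPprime hc.1 (fun ℓ ↦ ℓ.2.2.2) n
    rw [hcond]
    refine ⟨⟨hsq, fun q hq ↦ ?_⟩, fun q hq ↦ ?_, hnd⟩
    · rw [hfac, Finset.mem_union, Finset.mem_image] at hq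
      rcases hq with hq | ⟨ℓ, -, rfl⟩
      · exact ⟨(hc.2 q hq).1, le_trans (Nat.le_add_right k u) (hcidx q hq)⟩
      · exact ⟨ℓ.2.1, hPk ℓ⟩
    · rw [hfac, Finset.mem_union, Finset.mem_image] at hq
      rcases hq with hq | ⟨ℓ, -, rfl⟩
      · exact hcidx q hq
      · exact ℓ.2.2.1
  -- the admissible conductor of `n`, as a point of the data subtype
  let sadm : Finset P → {m : ℕ // Squarefree m ∧ ∀ q ∈ m.primeFactors,
      Zhang2014.IsKolyvaginPrime (W.conductorNorm ℤ) W K p q ∧ k ≤ Zhang2014.kolyvaginIndex W p q} :=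
    fun n ↦ ⟨cond n, (hadm n).1⟩
  have hsadm_empty : sadm ∅ = ⟨c, hc⟩ := Subtype.ext hcond_empty
  have hsadm_insert : ∀ (n : Finset P) (ℓ : P), ℓ ∉ n → (sadm (insert ℓ n)).1 = (sadm n).1 * ℓ :=
    fun n ℓ hℓ ↦ hcond_insert n ℓ hℓ
  have hcond0 : ∀ n : Finset P, cond n ≠ 0 := fun n ↦ (hadm n).1.1.ne_zero
  have hMn : ∀ n : Finset P, (k : ℕ∞) + mcc ≤ Zhang2014.levelIndex W p (cond n) := fun n ↦ by
    rw [← hku]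
    exact Zhang2014.natCast_le_levelIndex_iff.mpr (hadm n).2.1
  -- places: `λ ∉ placesDividing (cond n)` for `ℓ ∉ n`, and the insertion rule
  have hlam_not : ∀ (n : Finset P) (ℓ : P), ℓ ∉ n → lam ℓ ∉ placesDividing K (cond n) :=
    fun n ℓ hℓ ↦ Walk.not_mem_placesDividing_of_not_dvd (hPprime ℓ) (hlam_mem ℓ) ((hadm n).2.2 ℓ hℓ)
  have hplaces_insert : ∀ (n : Finset P) (ℓ : P), ℓ ∉ n →
      placesDividing K (cond (insert ℓ n)) = insert (lam ℓ) (placesDividing K (cond n)) := by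
    intro n ℓ hℓ
    rw [hcond_insert n ℓ hℓ]
    exact Walk.placesDividing_mul_eq_insert (hcond0 n) (hPprime ℓ) ℓ.2.1.2.2.2.2.1 (hlam_mem ℓ)
  -- the carrier places avoid the places dividing the conductors
  have hQnot : ∀ (n : Finset P), ∀ v ∈ Qcar, v ∉ placesDividing K (cond n) := by
    intro n v hv hmem
    rw [SelmerVocabulary.mem_placesDividing_iff_natCast_mem (hcond0 n),
      SelmerVocabulary.natCast_mem_iff_exists_primeFactor_mem (hcond0 n)] at hmem
    obtain ⟨q, hq, hqv⟩ := hmem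
    have hqK := ((hadm n).1.2 q hq).1
    exact Method2.not_mem_asIdeal_of_coprime (K := K) ((Nat.Prime.coprime_iff_not_dvd hqK.1).mpr hqK.2.1)
      v hqv (hQcar v hv)
  -- admissibility «ℓ above every prime factor of the conductor» implies freshness
  have hAdmP : ∀ (n : Finset P) (ℓ : P), (∀ q ∈ (cond n).primeFactors, q < (ℓ : ℕ)) → ℓ ∉ n := by
    intro n ℓ hlt hmem
    have hfac : (ℓ : ℕ) ∈ (cond n).primeFactors := by
      obtain ⟨_, hfac, _⟩ := Walk.squarefree_mul_prod_facts (fun ℓ : P ↦ (ℓ : ℕ))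
        Subtype.val_injective hPprime hc.1 (fun ℓ ↦ ℓ.2.2.2) n
      rw [hcond n, hfac, Finset.mem_union]
      exact Or.inr (Finset.mem_image_of_mem _ hmem)
    exact lt_irrefl _ (hlt _ hfac)
  -- every conductor of the walk is a multiple of `c`
  have hcdvd : ∀ n : Finset P, c ∣ (sadm n).1 := fun n ↦ by
    show c ∣ cond n; rw [hcond]; exact Dvd.intro _ rfl
  -- ### block 2: Thm 5.1 at the carrier, per conductor (choice)
  choose Qg Qg' instQ instQ' instFin locq locq' hker horth_q hQcyc hQcard using
    fun n : Finset P ↦ hdual_q (sadm n) (hcdvd n)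
  -- ### block 2: duality at `λ`, per (conductor, prime) — totalised in `ℓ`
  have hdl : ∀ (n : Finset P) (ℓ : P), ∃ (Sg : Type) (_ : AddCommGroup Sg)
      (sing : signPart W K τ ((p ^ k : ℕ) : ℤ) (if !eb (cond n) then 1 else -1)
          (((selmerF0 W ((p ^ k : ℕ) : ℤ) 𝒯 𝒮 (placesDividing K (cond n)) Qcar).relaxedAt
            {lam ℓ}).selmerGroup) →+ Sg),
      (∀ q ∈ (cond n).primeFactors, q < (ℓ : ℕ)) →
        ((∀ x, sing x = 0 ↔
          (x : galoisCohomology ((W.baseChange K).torsionGaloisModule ((p ^ k : ℕ) : ℤ)) 1) ∈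
            signPart W K τ ((p ^ k : ℕ) : ℤ) (if !eb (cond n) then 1 else -1)
              ((selmerF0 W ((p ^ k : ℕ) : ℤ) 𝒯 𝒮 (placesDividing K (cond n)) Qcar).selmerGroup)) ∧
        Nat.card sing.range *
          Nat.card ((C' (cond n)).map (galoisCohomology.localization
            ((W.baseChange K).torsionGaloisModule ((p ^ k : ℕ) : ℤ)) (Sum.inr (lam ℓ)) 1)) = p ^ k) := by
    intro n ℓ
    by_cases hℓ : ∀ q ∈ (cond n).primeFactors, q < (ℓ : ℕ)
    · obtain ⟨Sg, inst, sing, h1, h2⟩ := hdual_ℓ (sadm n) ℓ ℓ.2.1 (hPk ℓ) ((hadm n).2.2 ℓ (hAdmP n ℓ hℓ))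
        hℓ (hcdvd n) (lam ℓ) (hlam_mem ℓ)
      exact ⟨Sg, inst, sing, fun _ ↦ ⟨h1, h2⟩⟩
    · exact ⟨PUnit, inferInstance, 0, fun h ↦ absurd h hℓ⟩
  choose Sg instSg sing hsing_all using hdl
  letI : ∀ n, AddCommGroup (Qg n) := instQ
  letI : ∀ n, AddCommGroup (Qg' n) := instQ'
  haveI : ∀ n, Finite (Qg' n) := instFin
  letI : ∀ n ℓ, AddCommGroup (Sg n ℓ) := instSg
  -- ### the abstract walk, instantiated
  have key := JET.Section6.tamagawaExponent_le_m_of_selmerFamilies_adm (P := P) hp htk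
    (loc := fun ℓ ↦ galoisCohomology.localization
      ((W.baseChange K).torsionGaloisModule ((p ^ k : ℕ) : ℤ)) (Sum.inr (lam ℓ)) 1)
    (Hf := fun ℓ _ ↦ (W.baseChange K).kummerSelmerStructure ((p ^ k : ℕ) : ℤ) (Sum.inr (lam ℓ)))
    (Htr := fun ℓ _ ↦ 𝒯 (Sum.inr (lam ℓ)))
    ?hdisj
    (Gs := fun b ↦ signPart W K τ ((p ^ k : ℕ) : ℤ) (if b then 1 else -1) ⊤)
    (Sel := fun n b ↦ signPart W K τ ((p ^ k : ℕ) : ℤ) (if b then 1 else -1)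
      (selmerF W ((p ^ k : ℕ) : ℤ) 𝒯 (placesDividing K (cond n))).selmerGroup)
    (Rel := fun n ℓ b ↦ signPart W K τ ((p ^ k : ℕ) : ℤ) (if b then 1 else -1)
      ((selmerF W ((p ^ k : ℕ) : ℤ) 𝒯 (placesDividing K (cond n))).relaxedAt {lam ℓ}).selmerGroup)
    ?hSelGs (Adm := fun n ℓ ↦ ∀ q ∈ (cond n).primeFactors, q < (ℓ : ℕ)) hAdmP ?hfin ?hSel ?hSelT ?hPT
    (e := fun n ↦ eb (cond n)) ?he ?h61
    (M := fun n ↦ Zhang2014.levelIndex W p (cond n))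
    (mdiv := fun n ↦ divOrd (D (sadm n)) p)
    (mc := fun n ↦ if divOrd (D (sadm n)) p < Zhang2014.levelIndex W p (cond n)
      then divOrd (D (sadm n)) p else ⊤)
    ?hm ?hM
    (κ := fun n ↦ ((D (sadm n)).kolyvaginClass hp k :
      galoisCohomology ((W.baseChange K).torsionGaloisModule ((p ^ k : ℕ) : ℤ)) 1))
    (κt := fun n ↦ if h : (if divOrd (D (sadm n)) p < Zhang2014.levelIndex W p (cond n)
        then divOrd (D (sadm n)) p else (⊤ : ℕ∞)) + (k : ℕ∞) ≤ Zhang2014.levelIndex W p (cond n)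
      then Classical.choose (hκt (sadm n) (hcdvd n) h) else 0)
    ?hκt ?hordκ ?h47 ?h0
    (B' := fun n ↦ signPart W K τ ((p ^ k : ℕ) : ℤ) (if !eb (cond n) then 1 else -1)
      (selmerF0 W ((p ^ k : ℕ) : ℤ) 𝒯 𝒮 (placesDividing K (cond n)) Qcar).selmerGroup)
    (C' := fun n ↦ C' (cond n)) ?hB' ?hC'Gs
    (Q := Qg) (Q' := Qg') (locq := locq) (locq' := locq') hker horth_q hQcyc hQcard
    (D' := fun n ℓ ↦ signPart W K τ ((p ^ k : ℕ) : ℤ) (if !eb (cond n) then 1 else -1)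
      (((selmerF0 W ((p ^ k : ℕ) : ℤ) 𝒯 𝒮 (placesDividing K (cond n)) Qcar).relaxedAt
        {lam ℓ}).selmerGroup))
    (S := Sg) (sing := sing) ?hsing ?horthl ?h49
  · -- read the conclusion at the empty conductor `cond ∅ = c`
    beta_reduce at key
    rwa [hsadm_empty, hcond_empty] at key
  case hdisj =>
    intro ℓ b
    exact hdisj ℓ ℓ.2.1 (hPk ℓ) ℓ.2.2.2 (lam ℓ) (hlam_mem ℓ)
  case hSelGs =>
    intro n b
    exact Walk.signPart_le_signPart_top W K τ _ _ _
  case hfin =>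
    intro n ℓ b _
    haveI := hfin (cond n) (lam ℓ)
    exact Finite.of_injective _ (AddSubgroup.inclusion_injective (inf_le_left
      (a := ((selmerF W ((p ^ k : ℕ) : ℤ) 𝒯 (placesDividing K (cond n))).relaxedAt {lam ℓ}).selmerGroup)
      (b := (conjActH1 W K τ ((p ^ k : ℕ) : ℤ) - (if b then (1 : ℤ) else -1) •
        AddMonoidHom.id _).ker)))
  case hSel =>
    intro n ℓ b hA
    have hℓ := hAdmP n ℓ hA
    show signPart W K τ _ _ (selmerF W _ 𝒯 (placesDividing K (cond n))).selmerGroup = _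
    rw [← Walk.signPart_inf_right]
    congr 1
    exact Walk.selmerGroup_transverseAt_eq_relaxedAt_inf _ 𝒯 (hlam_not n ℓ hℓ)
  case hSelT =>
    intro n ℓ b hA
    have hℓ := hAdmP n ℓ hA
    show signPart W K τ _ _ (selmerF W _ 𝒯 (placesDividing K (cond (insert ℓ n)))).selmerGroup = _
    rw [hplaces_insert n ℓ hℓ, ← Walk.signPart_inf_right]
    congr 1
    exact Walk.selmerGroup_transverseAt_insert _ 𝒯 _ (lam ℓ)
  case hPT =>
    intro n ℓ b hA
    exact hPT (sadm n) ℓ ℓ.2.1 (hPk ℓ) ((hadm n).2.2 ℓ (hAdmP n ℓ hA)) hA (hcdvd n) (lam ℓ) (hlam_mem ℓ)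
      b
  case he =>
    intro n ℓ hA
    have hℓ := hAdmP n ℓ hA
    rw [hcond_insert n ℓ hℓ]
    exact heb (cond n) ℓ (hPprime ℓ) ((hadm n).2.2 ℓ hℓ)
  case h61 =>
    intro b x y hx hy hy0 n
    rw [Walk.mem_signPart_top_iff] at hx hy
    have hes : ((if b then (1 : ℤ) else -1) = 1 ∨ (if b then (1 : ℤ) else -1) = -1) := by
      cases b <;> simp
    have hy' : conjAct W τ ((p ^ k : ℕ) : ℤ) y = (-(if b then (1 : ℤ) else -1)) • y := by
      rw [hy]; cases b <;> simp
    obtain ⟨ℓ₀, hbℓ, hZ, hidx, hord⟩ := hCeb u hes x y hx hy' hy0 (cond n)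
    have hcle : c ≤ cond n := by
      rw [hcond]
      exact Nat.le_mul_of_pos_right _ (Finset.prod_pos fun ℓ _ ↦ (hPprime ℓ).pos)
    have hℓc : ¬ ℓ₀ ∣ c := fun h ↦ by
      have := Nat.le_of_dvd (Nat.pos_of_ne_zero hc0) h
      omega
    refine ⟨⟨ℓ₀, hZ, hidx, hℓc⟩, fun q hq ↦ ?_, hord (lam ⟨ℓ₀, hZ, hidx, hℓc⟩) (hlam_mem _)⟩
    exact lt_of_le_of_lt (Nat.le_of_mem_primeFactors hq) hbℓ
  case hm =>
    intro n h
    rw [if_pos h]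
  case hM =>
    intro n
    rw [hsadm_empty, hcond_empty]
    exact hMn n
  case hκt =>
    intro n h
    simp only [dif_pos h]
    exact Classical.choose_spec (hκt (sadm n) (hcdvd n) h)
  case hordκ =>
    intro n j hj hdvd
    exact hordκ (sadm n) j hj hdvd
  case h47 =>
    intro n ℓ hA
    have hℓ := hAdmP n ℓ hA
    exact h47 (sadm n) (sadm (insert ℓ n)) ℓ (hPprime ℓ) ((hadm n).2.2 ℓ hℓ) (hsadm_insert n ℓ hℓ) hA
      (hcdvd n) (lam ℓ) (hlam_mem ℓ)
  case h0 =>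
    rw [hsadm_empty, hcond_empty]
    exact h0
  case hB' =>
    intro n
    exact signPart_mono W K τ _ _ (Walk.selmerGroup_selmerF0_le W _ 𝒯 𝒮 hS (hQnot n))
  case hC'Gs =>
    intro n
    exact hC (cond n)
  case hsing =>
    intro n ℓ x hℓ
    exact (hsing_all n ℓ hℓ).1 x
  case horthl =>
    intro n ℓ hℓ
    exact (hsing_all n ℓ hℓ).2
  case h49 =>
    intro n ℓ hA
    have hℓ := hAdmP n ℓ hA
    exact h49 (sadm n) (sadm (insert ℓ n)) ℓ (hPprime ℓ) ((hadm n).2.2 ℓ hℓ) (hsadm_insert n ℓ hℓ) hA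
      (hcdvd n) (lam ℓ) (hlam_mem ℓ)

end Summit.BirchSwinnertonDyer.Rank1Residual.X11b.Three.Koly

end
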